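import Literature.NumberTheory.Transcendental.QuadraticRelationsLogarithmsSec4Regular
import Mathlib.LinearAlgebra.Matrix.Block
import HarnessLib

/-!
# Roy–Waldschmidt 1997, §4: heights of subspaces and Lemme 4.5

D. Roy, M. Waldschmidt, *Approximation diophantienne et indépendance algébrique de logarithmes*,
Ann. Sci. ÉNS (4) 30 (1997) 753–796, §4, pp. 773–775.

> "Pour chaque entier `n ≥ 0`, on étend la notion de hauteur aux sous-espaces `V` de `Kⁿ`. Si
> `V ≠ 0` et si `{x₁, …, x_m}` désigne une base quelconque de `V`, on définit la hauteur de `V` par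
> `h(V) = h(x₁ ∧ ⋯ ∧ x_m)`, c'est-à-dire comme étant la hauteur du point projectif déterminé par le
> `(n choose m)`-uplet dont les coordonnées sont les mineurs d'ordre `m` de la matrice `m × n` ayant
> pour lignes `x₁, …, x_m`. Si `V = 0`, on pose simplement `h(V) = 0`. Ainsi, pour tout sous-espace
> `V` de `Kⁿ` défini sur `ℚ`, on a `h(V) = 0`.
>
> **Lemme 4.5.** Soient `V₁, V₂` des sous-espaces de `Kⁿ`. On pose `U = V₁ ∩ V₂` et `W = V₁ + V₂`.
> Alors, on a `h(U) + h(W) ≤ h(V₁) + h(V₂)` (4.1). De plus, si `h(V₁) + h(V₂) < D`, alors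
> `Ū = V̄₁ ∩ V̄₂` et `W̄ = V̄₁ + V̄₂`."

(`D` the degree of the fixed place `𝔭`, bars denoting reduction at `𝔭`, file `…Sec4Regular`.)

This file defines `subspaceHeight k V = h(V)` (through the Plücker coordinates `minors` of a basis;
`subspaceHeight_eq` shows independence of the basis, `subspaceHeight_bot`, `subspaceHeight_nonneg`,
`subspaceHeight_eq_zero_of_isAlgebraic` = "`h(V) = 0` pour `V` défini sur `ℚ`") and proves
**Lemme 4.5** as printed: `lemme_4_5` (the inequality (4.1)) and `lemme_4_5_reduction` (the
compatibility of reduction with `∩` and `+` below `D`), following the printed proof — adapted bases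
`{u}, {u, x}, {u, y}, {u, x, y}` of `U, V₁, V₂, W` (`AdaptedBases`), the place-by-place inequality
(4.3) obtained by comparison with `q`-regular bases (`AdaptedBases.exists_defect`: "la différence
entre le membre de gauche et le membre de droite de (4.3) est une constante indépendante du choix
des `uᵢ, xᵢ, yᵢ`" — the change of bases is block-triangular), and the summation over all places.

Everything is proved; no named facts are introduced.

## References

* [RoyWaldschmidt1997ENS] D. Roy, M. Waldschmidt, Ann. Sci. ÉNS (4) 30 (1997) 753–796, §4,
  p. 773 (definition of `h(V)`), Lemme 4.5 pp. 774–775.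
* W. M. Schmidt, *Diophantine Approximation*, LNM 785, Ch. I, Lemma 8A (the number-field analogue
  of (4.1), cited by the paper).
-/

noncomputable section

open scoped Classical

namespace Literature.NumberTheory.Transcendental

namespace RoyWaldschmidt1997

open Literature.NumberTheory.DiophantineGeometry
open Literature.NumberTheory.DiophantineGeometry.AlgFunctionField

universe u v

variable {k : Type u} {K : Type v} [Field k] [Field K] [Algebra k K]

open Module Submodule

variable {n : Type*} [Fintype n]

/-! ### Reindexing the coordinates of a projective point -/

section Reindex

variable {ι ι' : Type*} [Fintype ι] [Fintype ι']

omit [Fintype n] in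
/-- `ord_q` of a tuple is invariant under reindexing of the coordinates. [folklore] -/
theorem ordVec_comp_equiv (q : PlaceOver k K) (v : ι → K) (σ : ι' ≃ ι) :
    ordVec q (v ∘ σ) = ordVec q v := by
  by_cases hv : v = 0
  · subst hv
    rw [show ((0 : ι → K) ∘ σ) = 0 from rfl, ordVec_zero, ordVec_zero]
  have hv' : v ∘ σ ≠ 0 := fun h ↦ hv (by
    funext i
    have := congr_fun h (σ.symm i)
    simpa using this)
  refine le_antisymm ?_ ?_
  · rw [le_ordVec_iff q hv]
    intro i hi
    have := ordVec_le q (x := v ∘ σ) (i := σ.symm i) (by simpa using hi)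
    simpa using this
  · rw [le_ordVec_iff q hv']
    intro i hi
    exact ordVec_le q (x := v) (i := σ i) hi

omit [Fintype n] in
/-- The projective height is invariant under reindexing of the coordinates. [folklore] -/
theorem projHeight_comp_equiv (v : ι → K) (σ : ι' ≃ ι) : projHeight k (v ∘ σ) = projHeight k v := by
  simp only [projHeight, ordVec_comp_equiv]

end Reindex

/-! ### Algebra of maximal minors -/

section MinorsAlgebra

variable {F : Type*} [CommRing F] {r r' : Type*} [Fintype r] [DecidableEq r] [Fintype r']
  [DecidableEq r']

omit [Fintype n] in
/-- Reindexing the rows reindexes the Plücker coordinates. [folklore] -/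
theorem minors_comp_equiv (e : r' ≃ r) (x : r → n → F) (g : r' → n) :
    minors (x ∘ e) g = minors x (g ∘ e.symm) := by
  rw [minors_apply, minors_apply]
  have : (Matrix.of fun i j ↦ (x ∘ e) i (g j)) =
      (Matrix.of fun i j ↦ x i ((g ∘ e.symm) j)).submatrix e e := by
    ext i j; simp
  rw [this, Matrix.det_submatrix_equiv_self]

omit [Fintype n] in
/-- Reindexing the rows reindexes the Plücker coordinates (as vectors). [folklore] -/
theorem minors_comp_equiv_eq (e : r' ≃ r) (x : r → n → F) :
    minors (x ∘ e) = minors x ∘ (Equiv.arrowCongr e (Equiv.refl n)) := by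
  funext g
  exact minors_comp_equiv e x g

omit [Fintype n] in
/-- **Change of basis**: if `yᵢ = ∑ₗ Aᵢₗ xₗ` then `y₁ ∧ ⋯ ∧ y_m = det(A) · x₁ ∧ ⋯ ∧ x_m`.
[cite: RoyWaldschmidt1997ENS, §4, p. 773] -/
theorem minors_matrix_smul (A : Matrix r r F) (x : r → n → F) (f : r → n) :
    minors (fun i ↦ ∑ l, A i l • x l) f = A.det * minors x f := by
  rw [minors_apply, minors_apply, ← Matrix.det_mul]
  congr 1
  ext i j
  simp [Matrix.mul_apply, Finset.sum_apply]

end MinorsAlgebra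

omit [Fintype n] in
/-- Minors of a matrix with entries algebraic over `k` are algebraic over `k`. [folklore] -/
theorem isAlgebraic_minors {r : Type*} [Fintype r] [DecidableEq r] {x : r → n → K}
    (h : ∀ i j, IsAlgebraic k (x i j)) (f : r → n) : IsAlgebraic k (minors x f) := by
  have hint : ∀ i j, x i j ∈ integralClosure k K := fun i j ↦
    (mem_integralClosure_iff k K).2 (h i j).isIntegral
  set M : Matrix r r (integralClosure k K) := Matrix.of fun i j ↦ ⟨x i (f j), hint i (f j)⟩ with hM
  have hdet : ((M.det : integralClosure k K) : K) = minors x f := by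
    rw [show ((M.det : integralClosure k K) : K) = algebraMap (integralClosure k K) K M.det from rfl,
      RingHom.map_det, RingHom.mapMatrix_apply, minors_apply]
    rfl
  rw [← hdet]
  exact ((mem_integralClosure_iff k K).1 M.det.2).isAlgebraic

/-! ### The height of a subspace -/

omit [Fintype n] in
/-- The canonical basis family of a subspace, read in `Kⁿ`, is a basis of it. [folklore] -/
theorem finBasis_family (V : Submodule K (n → K)) [FiniteDimensional K V] :
    LinearIndependent K (fun i ↦ ((Module.finBasis K V i : V) : n → K)) ∧
      span K (Set.range fun i ↦ ((Module.finBasis K V i : V) : n → K)) = V := by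
  refine ⟨(Module.finBasis K V).linearIndependent.map' V.subtype (Submodule.ker_subtype _), ?_⟩
  have h2 := congrArg (Submodule.map V.subtype) (Module.finBasis K V).span_eq
  rw [Submodule.map_span, Submodule.map_top, Submodule.range_subtype, ← Set.range_comp] at h2
  exact h2

variable (k) in
/-- **The height `h(V)` of a subspace `V ⊆ Kⁿ`**: the height of the projective point whose
coordinates are the maximal minors of the matrix of a basis of `V` (here the canonical
`Module.finBasis`; `subspaceHeight_eq` shows that any basis gives the same value); for `V = 0` the
unique (empty) minor is `1` and `h(0) = 0` (`subspaceHeight_bot`).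
[cite: RoyWaldschmidt1997ENS, §4, p. 773] -/
def subspaceHeight (V : Submodule K (n → K)) : ℤ :=
  projHeight k (minors fun i ↦ ((Module.finBasis K V i : V) : n → K))

/-- **`h(V)` does not depend on the basis**: for any basis `x₁, …, x_m` of `V`,
`h(V) = h(x₁ ∧ ⋯ ∧ x_m)` (change of basis multiplies all minors by a nonzero determinant, and the
projective height is invariant). [cite: RoyWaldschmidt1997ENS, §4, p. 773] -/
theorem subspaceHeight_eq [IsAlgFunctionField k K] {r : Type*} [Fintype r] [DecidableEq r]
    {V : Submodule K (n → K)} {x : r → n → K} (hli : LinearIndependent K x)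
    (hspan : span K (Set.range x) = V) : subspaceHeight k V = projHeight k (minors x) := by
  obtain ⟨bli, bspan⟩ := finBasis_family V
  set b : Fin (finrank K V) → n → K := fun i ↦ ((Module.finBasis K V i : V) : n → K) with hb
  have hcard : Fintype.card r = Fintype.card (Fin (finrank K V)) := by
    rw [Fintype.card_fin, ← hspan, finrank_span_eq_card hli]
  obtain ⟨e⟩ : Nonempty (r ≃ Fin (finrank K V)) := Fintype.card_eq.1 hcard
  have h1 : subspaceHeight k V = projHeight k (minors (b ∘ e)) := by
    rw [minors_comp_equiv_eq, projHeight_comp_equiv]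
    rfl
  have hbe_span : span K (Set.range (b ∘ e)) = V := by
    rw [e.surjective.range_comp]; exact bspan
  have hmem : ∀ i, x i ∈ span K (Set.range (b ∘ e)) := fun i ↦ by
    rw [hbe_span, ← hspan]; exact subset_span ⟨i, rfl⟩
  choose A hA using fun i ↦ (Submodule.mem_span_range_iff_exists_fun K).1 (hmem i)
  have hx : x = fun i ↦ ∑ l, (Matrix.of A) i l • (b ∘ e) l := by
    funext i; exact (hA i).symm
  have hmin : minors x = (Matrix.of A).det • minors (b ∘ e) := by
    funext f
    rw [Pi.smul_apply, smul_eq_mul, ← minors_matrix_smul, ← hx]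
  have hdet : (Matrix.of A).det ≠ 0 := by
    obtain ⟨f, hf⟩ := exists_minors_ne_zero hli
    rw [hmin] at hf
    exact left_ne_zero_of_mul hf
  rw [h1, hmin, projHeight_smul _ hdet]

/-- `h(V) ≥ 0`. [cite: RoyWaldschmidt1997ENS, §4, p. 773] -/
theorem subspaceHeight_nonneg [IsAlgFunctionField k K] (V : Submodule K (n → K)) :
    0 ≤ subspaceHeight k V :=
  projHeight_nonneg _

/-- **"Pour tout sous-espace `V` de `Kⁿ` défini sur `ℚ`, on a `h(V) = 0`"**: a subspace with a
basis of vectors whose coordinates are algebraic over `k` (e.g. in `k`) has height `0`.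
[cite: RoyWaldschmidt1997ENS, §4, p. 773] -/
theorem subspaceHeight_eq_zero_of_isAlgebraic [IsAlgFunctionField k K] {r : Type*} [Fintype r]
    [DecidableEq r] {V : Submodule K (n → K)} {x : r → n → K} (hli : LinearIndependent K x)
    (hspan : span K (Set.range x) = V) (halg : ∀ i j, IsAlgebraic k (x i j)) :
    subspaceHeight k V = 0 := by
  rw [subspaceHeight_eq hli hspan]
  exact projHeight_eq_zero_of_isAlgebraic fun f ↦ isAlgebraic_minors halg f

/-- `h(0) = 0`. [cite: RoyWaldschmidt1997ENS, §4, p. 773] -/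
theorem subspaceHeight_bot [IsAlgFunctionField k K] : subspaceHeight k (⊥ : Submodule K (n → K)) = 0 :=
  subspaceHeight_eq_zero_of_isAlgebraic (r := Fin 0) (x := fun i ↦ i.elim0)
    linearIndependent_empty_type (by simp) fun i ↦ i.elim0

/-- A subspace spanned by standard basis vectors has height `0` (the space `V₀` of the proof of
Lemme 4.6, or `0 × K^{d₁}`, `A^{d₀} × T_{H₁}` of the proof of Théorème 4.1).
[cite: RoyWaldschmidt1997ENS, §4, p. 773] -/
theorem subspaceHeight_span_single [IsAlgFunctionField k K] [DecidableEq n] (s : Set n) :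
    subspaceHeight k (span K ((fun j ↦ (Pi.single j 1 : n → K)) '' s)) = 0 := by
  have hli : LinearIndependent K (fun j : s ↦ (Pi.single (j : n) 1 : n → K)) :=
    (Pi.linearIndependent_single_one n K).comp _ Subtype.val_injective
  refine subspaceHeight_eq_zero_of_isAlgebraic (r := s) hli ?_ fun i j ↦ ?_
  · congr 1
    ext v
    simp
  · by_cases h : (i : n) = j
    · subst h; simpa using isAlgebraic_one
    · rw [Pi.single_eq_of_ne' h]; exact isAlgebraic_zero

/-! ### Concatenated families -/

section Families

variable {R M : Type*} [Ring R] [AddCommGroup M] [Module R M]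

/-- `span (u, v) = span u + span v`. [folklore] -/
theorem span_range_sum_elim {α β : Type*} (u : α → M) (v : β → M) :
    span R (Set.range (Sum.elim u v)) = span R (Set.range u) ⊔ span R (Set.range v) := by
  rw [Set.Sum.elim_range, span_union]

/-- If `Su` meets `Sx + Sy` trivially and `Sx` meets `Sy` trivially then
`(Su + Sx) ∩ (Su + Sy) = Su` (the linear algebra behind `Ū = V̄₁ ∩ V̄₂` in Lemme 4.5). [folklore] -/
theorem sup_inf_sup_eq_of_disjoint {Su Sx Sy : Submodule R M} (h1 : Disjoint Su (Sx ⊔ Sy))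
    (h2 : Disjoint Sx Sy) : (Su ⊔ Sx) ⊓ (Su ⊔ Sy) = Su := by
  refine le_antisymm ?_ (le_inf le_sup_left le_sup_left)
  intro w hw
  obtain ⟨hw1, hw2⟩ := Submodule.mem_inf.1 hw
  obtain ⟨a, ha, b, hb, rfl⟩ := Submodule.mem_sup.1 hw1
  obtain ⟨a', ha', c, hc, heq⟩ := Submodule.mem_sup.1 hw2
  have hbc : b - c ∈ Su := by
    have : b - c = a' - a := by
      rw [sub_eq_sub_iff_add_eq_add, add_comm b a]; exact heq.symm
    rw [this]; exact sub_mem ha' ha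
  have hbc' : b - c ∈ Sx ⊔ Sy := sub_mem (mem_sup_left hb) (mem_sup_right hc)
  have h0 : b - c = 0 := by
    have := h1.le_bot (Submodule.mem_inf.2 ⟨hbc, hbc'⟩)
    simpa using this
  have hb_eq : b = c := sub_eq_zero.1 h0
  have hb0 : b = 0 := by
    have := h2.le_bot (Submodule.mem_inf.2 ⟨hb, hb_eq ▸ hc⟩)
    simpa using this
  rw [hb0, add_zero]
  exact ha

end Families

/-! ### Adapted bases of two subspaces (proof of Lemme 4.5) -/

section Adapted

variable {r₀ r₁ r₂ : Type*} [Fintype r₀] [Fintype r₁] [Fintype r₂]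

/-- **Adapted bases** for a pair of subspaces `V₁, V₂ ⊆ Kⁿ` (proof of Lemme 4.5): a basis `u` of
`U = V₁ ∩ V₂` completed on the one hand to a basis `(u, x)` of `V₁` and on the other hand to a
basis `(u, y)` of `V₂`. [cite: RoyWaldschmidt1997ENS, Lemme 4.5 (proof), p. 774] -/
structure AdaptedBases (V₁ V₂ : Submodule K (n → K)) (u : r₀ → n → K) (x : r₁ → n → K)
    (y : r₂ → n → K) : Prop where
  /-- `u` is linearly independent … -/
  li_u : LinearIndependent K u
  /-- … and spans `U = V₁ ∩ V₂`. -/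
  span_u : span K (Set.range u) = V₁ ⊓ V₂
  /-- `(u, x)` is linearly independent … -/
  li_ux : LinearIndependent K (Sum.elim u x)
  /-- … and spans `V₁`. -/
  span_ux : span K (Set.range (Sum.elim u x)) = V₁
  /-- `(u, y)` is linearly independent … -/
  li_uy : LinearIndependent K (Sum.elim u y)
  /-- … and spans `V₂`. -/
  span_uy : span K (Set.range (Sum.elim u y)) = V₂

namespace AdaptedBases

variable {V₁ V₂ : Submodule K (n → K)} {u : r₀ → n → K} {x : r₁ → n → K} {y : r₂ → n → K}

omit [Fintype n] [Fintype r₀] [Fintype r₁] [Fintype r₂] in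
/-- Then `(u, x, y)` is linearly independent … [cite: RoyWaldschmidt1997ENS, Lemme 4.5 (proof), p. 774] -/
theorem li_uxy (h : AdaptedBases V₁ V₂ u x y) : LinearIndependent K (Sum.elim u (Sum.elim x y)) := by
  have hy : LinearIndependent K y := h.li_uy.comp Sum.inr Sum.inr_injective
  have hdisj : Disjoint (span K (Set.range (Sum.elim u x))) (span K (Set.range y)) := by
    rw [h.span_ux]
    have hd := (linearIndependent_sum.1 h.li_uy).2.2
    simp only [Sum.elim_comp_inl, Sum.elim_comp_inr] at hd
    rw [Submodule.disjoint_def] at hd ⊢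
    intro w hw1 hwy
    have hw2 : w ∈ V₂ := by
      rw [← h.span_uy, span_range_sum_elim]; exact mem_sup_right hwy
    have hwU : w ∈ span K (Set.range u) := by rw [h.span_u]; exact ⟨hw1, hw2⟩
    exact hd w hwU hwy
  have h3 : LinearIndependent K (Sum.elim (Sum.elim u x) y) := h.li_ux.sum_type hy hdisj
  have heq : Sum.elim (Sum.elim u x) y = Sum.elim u (Sum.elim x y) ∘ Equiv.sumAssoc r₀ r₁ r₂ := by
    funext i; rcases i with (i | i) | i <;> rfl
  rw [heq] at h3
  exact (linearIndependent_equiv _).1 h3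

omit [Fintype n] [Fintype r₀] [Fintype r₁] [Fintype r₂] in
/-- … and is a basis of `W = V₁ + V₂`. [cite: RoyWaldschmidt1997ENS, Lemme 4.5 (proof), p. 774] -/
theorem span_uxy (h : AdaptedBases V₁ V₂ u x y) :
    span K (Set.range (Sum.elim u (Sum.elim x y))) = V₁ ⊔ V₂ := by
  rw [span_range_sum_elim, span_range_sum_elim, ← h.span_ux, ← h.span_uy, span_range_sum_elim,
    span_range_sum_elim, sup_sup_sup_comm (span K (Set.range u)) (span K (Set.range x))
      (span K (Set.range u)) (span K (Set.range y)), sup_idem]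

omit [Fintype n] in
/-- Cardinalities of adapted bases. [folklore] -/
theorem card_eq (h : AdaptedBases V₁ V₂ u x y) :
    Fintype.card r₀ = finrank K ↥(V₁ ⊓ V₂) ∧ Fintype.card r₀ + Fintype.card r₁ = finrank K V₁ ∧
      Fintype.card r₀ + Fintype.card r₂ = finrank K V₂ := by
  refine ⟨?_, ?_, ?_⟩
  · rw [← h.span_u, finrank_span_eq_card h.li_u]
  · rw [← h.span_ux, finrank_span_eq_card h.li_ux, Fintype.card_sum]
  · rw [← h.span_uy, finrank_span_eq_card h.li_uy, Fintype.card_sum]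

end AdaptedBases

/-- Adapted bases exist. [cite: RoyWaldschmidt1997ENS, Lemme 4.5 (proof), p. 774] -/
theorem exists_adaptedBases (V₁ V₂ : Submodule K (n → K)) :
    ∃ (m₀ m₁ m₂ : ℕ) (u : Fin m₀ → n → K) (x : Fin m₁ → n → K) (y : Fin m₂ → n → K),
      AdaptedBases V₁ V₂ u x y := by
  obtain ⟨uli, uspan⟩ := finBasis_family (V₁ ⊓ V₂)
  set u := fun i ↦ ((Module.finBasis K ↥(V₁ ⊓ V₂) i : ↥(V₁ ⊓ V₂)) : n → K) with hu
  have hmem : ∀ i, u i ∈ V₁ ⊓ V₂ := fun i ↦ (Module.finBasis K ↥(V₁ ⊓ V₂) i).2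
  obtain ⟨m₁, x, -, hli₁, hspan₁⟩ :=
    exists_linearIndependent_extension V₁ (v := u) (fun i ↦ (hmem i).1) uli
  obtain ⟨m₂, y, -, hli₂, hspan₂⟩ :=
    exists_linearIndependent_extension V₂ (v := u) (fun i ↦ (hmem i).2) uli
  exact ⟨_, m₁, m₂, u, x, y, ⟨uli, uspan, hli₁, hspan₁, hli₂, hspan₂⟩⟩

/-! ### The place-by-place inequality (4.3) -/

variable [DecidableEq r₀] [DecidableEq r₁] [DecidableEq r₂]

/-- **Inequality (4.3) at a place `𝔭`, with its defect.** For adapted bases `u, (u,x), (u,y)` of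
`U, V₁, V₂` and the basis `(u,x,y)` of `W`, there is `t ≥ 0` (namely `ord_𝔭` of the exterior
product of a `𝔭`-regular adapted basis of `W`) with
`ord_𝔭(u∧x) + ord_𝔭(u∧y) + t = ord_𝔭(u) + ord_𝔭(u∧x∧y)`;
and `t = 0` forces `W̄ = V̄₁ + V̄₂` and `V̄₁ ∩ V̄₂ = Ū` (proof of Lemme 4.5: comparison with `𝔭`-regular
bases through a block-triangular change of bases, whose determinants cancel).
[cite: RoyWaldschmidt1997ENS, Lemme 4.5 (proof), pp. 774–775] -/
theorem AdaptedBases.exists_defect [IsAlgFunctionField k K] {V₁ V₂ : Submodule K (n → K)}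
    {u : r₀ → n → K} {x : r₁ → n → K} {y : r₂ → n → K} (h : AdaptedBases V₁ V₂ u x y)
    (p : PlaceOver k K) :
    ∃ t : ℤ, 0 ≤ t ∧
      ordVec p (minors (Sum.elim u x)) + ordVec p (minors (Sum.elim u y)) + t =
        ordVec p (minors u) + ordVec p (minors (Sum.elim u (Sum.elim x y))) ∧
      (t = 0 → reduction p (V₁ ⊔ V₂) = reduction p V₁ ⊔ reduction p V₂ ∧
        reduction p V₁ ⊓ reduction p V₂ = reduction p (V₁ ⊓ V₂)) := by
  obtain ⟨hc₀, hc₁, hc₂⟩ := h.card_eq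
  -- `𝔭`-regular adapted bases with the same index types
  obtain ⟨u', hu'⟩ := exists_isRegularBasis_of_card_eq p (V₁ ⊓ V₂) hc₀
  have hu'₁ : ∀ i, u' i ∈ integralPoints p V₁ := fun i ↦
    (mem_integralPoints p).2 ((mem_integralPoints p).1 (hu'.mem i)).1
  have hu'₂ : ∀ i, u' i ∈ integralPoints p V₂ := fun i ↦
    (mem_integralPoints p).2 ((mem_integralPoints p).1 (hu'.mem i)).2
  obtain ⟨x', hx'⟩ := lemme_4_4_of_card_eq hu'₁ hu'.linearIndependent_red hc₁
  obtain ⟨y', hy'⟩ := lemme_4_4_of_card_eq hu'₂ hu'.linearIndependent_red hc₂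
  -- the corresponding `K`-bases
  set a : r₀ → n → K := fun i ↦ inclVec p (u' i) with ha
  set b : r₁ → n → K := fun i ↦ inclVec p (x' i) with hb
  set c : r₂ → n → K := fun i ↦ inclVec p (y' i) with hc
  have hab : (fun i ↦ inclVec p (Sum.elim u' x' i)) = Sum.elim a b := by
    funext i; rcases i with i | i <;> rfl
  have hac : (fun i ↦ inclVec p (Sum.elim u' y' i)) = Sum.elim a c := by
    funext i; rcases i with i | i <;> rfl
  have habc : (fun i ↦ inclVec p (Sum.elim u' (Sum.elim x' y') i)) = Sum.elim a (Sum.elim b c) := by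
    funext i; rcases i with i | i | i <;> rfl
  have h' : AdaptedBases V₁ V₂ a b c :=
    ⟨hu'.linearIndependent, hu'.span_eq, by rw [← hab]; exact hx'.linearIndependent,
      by rw [← hab]; exact hx'.span_eq, by rw [← hac]; exact hy'.linearIndependent,
      by rw [← hac]; exact hy'.span_eq⟩
  -- orders of the regular exterior products
  obtain ⟨ha_ne, ha0⟩ := hu'.minors_inclVec_ne_zero_and_ordVec_eq_zero
  obtain ⟨hab_ne, hab0⟩ := hx'.minors_inclVec_ne_zero_and_ordVec_eq_zero
  obtain ⟨hac_ne, hac0⟩ := hy'.minors_inclVec_ne_zero_and_ordVec_eq_zero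
  rw [hab] at hab_ne hab0
  rw [hac] at hac_ne hac0
  change minors a ≠ 0 at ha_ne
  change ordVec p (minors a) = 0 at ha0
  have habc_nonneg : 0 ≤ ordVec p (minors (Sum.elim a (Sum.elim b c))) := by
    rw [← habc]; exact ordVec_minors_inclVec_nonneg p _
  have habc_ne : minors (Sum.elim a (Sum.elim b c)) ≠ 0 := by
    obtain ⟨f, hf⟩ := exists_minors_ne_zero h'.li_uxy
    exact fun h0 ↦ hf (congr_fun h0 f)
  -- express the fixed bases in the regular ones
  have hmem_u : ∀ i, u i ∈ span K (Set.range a) := fun i ↦ by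
    rw [h'.span_u, ← h.span_u]; exact subset_span ⟨i, rfl⟩
  choose A hA using fun i ↦ (Submodule.mem_span_range_iff_exists_fun K).1 (hmem_u i)
  have hmem_x : ∀ i, x i ∈ span K (Set.range (Sum.elim a b)) := fun i ↦ by
    rw [h'.span_ux, ← h.span_ux]; exact subset_span ⟨Sum.inr i, rfl⟩
  choose M₁ hM₁ using fun i ↦ (Submodule.mem_span_range_iff_exists_fun K).1 (hmem_x i)
  have hmem_y : ∀ i, y i ∈ span K (Set.range (Sum.elim a c)) := fun i ↦ by
    rw [h'.span_uy, ← h.span_uy]; exact subset_span ⟨Sum.inr i, rfl⟩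
  choose M₂ hM₂ using fun i ↦ (Submodule.mem_span_range_iff_exists_fun K).1 (hmem_y i)
  -- the block-triangular change-of-basis matrices
  set Am : Matrix r₀ r₀ K := Matrix.of A with hAm
  set C : Matrix r₁ r₀ K := Matrix.of fun i l ↦ M₁ i (Sum.inl l) with hC
  set B : Matrix r₁ r₁ K := Matrix.of fun i l ↦ M₁ i (Sum.inr l) with hB
  set E : Matrix r₂ r₀ K := Matrix.of fun i l ↦ M₂ i (Sum.inl l) with hE
  set D : Matrix r₂ r₂ K := Matrix.of fun i l ↦ M₂ i (Sum.inr l) with hD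
  set P₁ : Matrix (r₀ ⊕ r₁) (r₀ ⊕ r₁) K := Matrix.fromBlocks Am 0 C B with hP₁
  set P₂ : Matrix (r₀ ⊕ r₂) (r₀ ⊕ r₂) K := Matrix.fromBlocks Am 0 E D with hP₂
  set CE : Matrix (r₁ ⊕ r₂) r₀ K :=
    Matrix.of (Sum.elim (fun i l ↦ M₁ i (Sum.inl l)) (fun i l ↦ M₂ i (Sum.inl l))) with hCE
  set BD : Matrix (r₁ ⊕ r₂) (r₁ ⊕ r₂) K := Matrix.fromBlocks B 0 0 D with hBD
  set P : Matrix (r₀ ⊕ (r₁ ⊕ r₂)) (r₀ ⊕ (r₁ ⊕ r₂)) K := Matrix.fromBlocks Am 0 CE BD with hP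
  -- the four family identities
  have hu_eq : u = fun i ↦ ∑ l, Am i l • a l := by
    funext i; simp only [hAm, Matrix.of_apply]; exact (hA i).symm
  have hx_eq : ∀ i, x i = ∑ l, C i l • a l + ∑ l, B i l • b l := fun i ↦ by
    rw [← hM₁ i, Fintype.sum_sum_type]
    simp [hC, hB]
  have hy_eq : ∀ i, y i = ∑ l, E i l • a l + ∑ l, D i l • c l := fun i ↦ by
    rw [← hM₂ i, Fintype.sum_sum_type]
    simp [hE, hD]
  have hux_eq : Sum.elim u x = fun i ↦ ∑ l, P₁ i l • Sum.elim a b l := by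
    funext i
    rw [Fintype.sum_sum_type]
    rcases i with i | i
    · simp only [Sum.elim_inl, Sum.elim_inr, hP₁, Matrix.fromBlocks_apply₁₁,
        Matrix.fromBlocks_apply₁₂, Matrix.zero_apply, zero_smul, Finset.sum_const_zero, add_zero]
      exact congr_fun hu_eq i
    · simp only [Sum.elim_inr, Sum.elim_inl, hP₁, Matrix.fromBlocks_apply₂₁,
        Matrix.fromBlocks_apply₂₂]
      exact hx_eq i
  have huy_eq : Sum.elim u y = fun i ↦ ∑ l, P₂ i l • Sum.elim a c l := by
    funext i
    rw [Fintype.sum_sum_type]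
    rcases i with i | i
    · simp only [Sum.elim_inl, Sum.elim_inr, hP₂, Matrix.fromBlocks_apply₁₁,
        Matrix.fromBlocks_apply₁₂, Matrix.zero_apply, zero_smul, Finset.sum_const_zero, add_zero]
      exact congr_fun hu_eq i
    · simp only [Sum.elim_inr, Sum.elim_inl, hP₂, Matrix.fromBlocks_apply₂₁,
        Matrix.fromBlocks_apply₂₂]
      exact hy_eq i
  have huxy_eq : Sum.elim u (Sum.elim x y) = fun i ↦ ∑ l, P i l • Sum.elim a (Sum.elim b c) l := by
    funext i
    rw [Fintype.sum_sum_type]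
    rcases i with i | i | i
    · simp only [Sum.elim_inl, Sum.elim_inr, hP, Matrix.fromBlocks_apply₁₁,
        Matrix.fromBlocks_apply₁₂, Matrix.zero_apply, zero_smul, Finset.sum_const_zero, add_zero]
      exact congr_fun hu_eq i
    · simp only [Sum.elim_inr, Sum.elim_inl, hP, Matrix.fromBlocks_apply₂₁,
        Matrix.fromBlocks_apply₂₂, hCE, Matrix.of_apply, hBD]
      rw [Fintype.sum_sum_type]
      simp only [Matrix.fromBlocks_apply₁₁, Matrix.fromBlocks_apply₁₂, Matrix.zero_apply,
        zero_smul, Finset.sum_const_zero, add_zero, Sum.elim_inl, Sum.elim_inr]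
      exact hx_eq i
    · simp only [Sum.elim_inr, Sum.elim_inl, hP, Matrix.fromBlocks_apply₂₁,
        Matrix.fromBlocks_apply₂₂, hCE, Matrix.of_apply, hBD]
      rw [Fintype.sum_sum_type]
      simp only [Matrix.fromBlocks_apply₂₁, Matrix.fromBlocks_apply₂₂, Matrix.zero_apply,
        zero_smul, Finset.sum_const_zero, zero_add, Sum.elim_inl, Sum.elim_inr]
      exact hy_eq i
  -- the exterior products
  have hmu : minors u = Am.det • minors a := by
    funext f; rw [hu_eq, minors_matrix_smul, Pi.smul_apply, smul_eq_mul]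
  have hmux : minors (Sum.elim u x) = P₁.det • minors (Sum.elim a b) := by
    funext f; rw [hux_eq, minors_matrix_smul, Pi.smul_apply, smul_eq_mul]
  have hmuy : minors (Sum.elim u y) = P₂.det • minors (Sum.elim a c) := by
    funext f; rw [huy_eq, minors_matrix_smul, Pi.smul_apply, smul_eq_mul]
  have hmuxy : minors (Sum.elim u (Sum.elim x y)) = P.det • minors (Sum.elim a (Sum.elim b c)) := by
    funext f; rw [huxy_eq, minors_matrix_smul, Pi.smul_apply, smul_eq_mul]
  have hdP₁ : P₁.det = Am.det * B.det := Matrix.det_fromBlocks_zero₁₂ _ _ _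
  have hdP₂ : P₂.det = Am.det * D.det := Matrix.det_fromBlocks_zero₁₂ _ _ _
  have hdP : P.det = Am.det * (B.det * D.det) := by
    rw [hP, Matrix.det_fromBlocks_zero₁₂, hBD, Matrix.det_fromBlocks_zero₁₂]
  -- nonvanishing of the determinants
  have hA0 : Am.det ≠ 0 := by
    obtain ⟨f, hf⟩ := exists_minors_ne_zero h.li_u
    rw [hmu] at hf
    exact left_ne_zero_of_mul hf
  have hB0 : B.det ≠ 0 := by
    obtain ⟨f, hf⟩ := exists_minors_ne_zero h.li_ux
    rw [hmux, hdP₁] at hf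
    exact right_ne_zero_of_mul (left_ne_zero_of_mul hf)
  have hD0 : D.det ≠ 0 := by
    obtain ⟨f, hf⟩ := exists_minors_ne_zero h.li_uy
    rw [hmuy, hdP₂] at hf
    exact right_ne_zero_of_mul (left_ne_zero_of_mul hf)
  -- the orders
  have ho_u : ordVec p (minors u) = p.ord Am.det := by
    rw [hmu, ordVec_smul p ha_ne hA0, ha0, add_zero]
  have ho_ux : ordVec p (minors (Sum.elim u x)) = p.ord Am.det + p.ord B.det := by
    rw [hmux, ordVec_smul p hab_ne (hdP₁ ▸ mul_ne_zero hA0 hB0), hab0, add_zero, hdP₁,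
      p.ord_mul_eq hA0 hB0]
  have ho_uy : ordVec p (minors (Sum.elim u y)) = p.ord Am.det + p.ord D.det := by
    rw [hmuy, ordVec_smul p hac_ne (hdP₂ ▸ mul_ne_zero hA0 hD0), hac0, add_zero, hdP₂,
      p.ord_mul_eq hA0 hD0]
  have ho_uxy : ordVec p (minors (Sum.elim u (Sum.elim x y))) =
      p.ord Am.det + (p.ord B.det + p.ord D.det) + ordVec p (minors (Sum.elim a (Sum.elim b c))) := by
    rw [hmuxy, ordVec_smul p habc_ne (hdP ▸ mul_ne_zero hA0 (mul_ne_zero hB0 hD0)), hdP,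
      p.ord_mul_eq hA0 (mul_ne_zero hB0 hD0), p.ord_mul_eq hB0 hD0]
  refine ⟨ordVec p (minors (Sum.elim a (Sum.elim b c))), habc_nonneg, ?_, fun ht ↦ ?_⟩
  · rw [ho_u, ho_ux, ho_uy, ho_uxy]; ring
  -- the regular case: `(u', x', y')` is a `𝔭`-regular basis of `W`
  have hF_mem : ∀ i, Sum.elim u' (Sum.elim x' y') i ∈ integralPoints p (V₁ ⊔ V₂) := by
    rintro (i | i | i)
    · exact (mem_integralPoints p).2 (mem_sup_left ((mem_integralPoints p).1 (hu'₁ i)))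
    · exact (mem_integralPoints p).2 (mem_sup_left ((mem_integralPoints p).1 (hx'.mem (Sum.inr i))))
    · exact (mem_integralPoints p).2 (mem_sup_right ((mem_integralPoints p).1 (hy'.mem (Sum.inr i))))
  have hF_card : Fintype.card (r₀ ⊕ (r₁ ⊕ r₂)) = finrank K ↥(V₁ ⊔ V₂) := by
    rw [← h'.span_uxy, finrank_span_eq_card h'.li_uxy]
  have hF_vec : (fun f : r₀ ⊕ (r₁ ⊕ r₂) → n ↦
      ((minors (Sum.elim u' (Sum.elim x' y')) f : p.toValuationSubring) : K)) =
      minors (Sum.elim a (Sum.elim b c)) := by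
    rw [← habc]; funext f; exact (minors_inclVec_eq p _ f).symm
  have hW : IsRegularBasis p (V₁ ⊔ V₂) (Sum.elim u' (Sum.elim x' y')) :=
    isRegularBasis_of_ordVec_minors_eq_zero hF_mem hF_card (by rw [hF_vec]; exact habc_ne)
      (by rw [hF_vec]; exact ht)
  -- read off the reductions
  set Su := span p.residueField (Set.range fun i ↦ redVec p (u' i)) with hSu
  set Sx := span p.residueField (Set.range fun i ↦ redVec p (x' i)) with hSx
  set Sy := span p.residueField (Set.range fun i ↦ redVec p (y' i)) with hSy
  have hru : (fun i ↦ redVec p (Sum.elim u' x' i)) =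
      Sum.elim (fun i ↦ redVec p (u' i)) (fun i ↦ redVec p (x' i)) := by
    funext i; rcases i with i | i <;> rfl
  have hrv : (fun i ↦ redVec p (Sum.elim u' y' i)) =
      Sum.elim (fun i ↦ redVec p (u' i)) (fun i ↦ redVec p (y' i)) := by
    funext i; rcases i with i | i <;> rfl
  have hrw : (fun i ↦ redVec p (Sum.elim u' (Sum.elim x' y') i)) =
      Sum.elim (fun i ↦ redVec p (u' i))
        (Sum.elim (fun i ↦ redVec p (x' i)) (fun i ↦ redVec p (y' i))) := by
    funext i; rcases i with i | i | i <;> rfl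
  have hU : reduction p (V₁ ⊓ V₂) = Su := hu'.span_red.symm
  have hV₁ : reduction p V₁ = Su ⊔ Sx := by
    rw [← hx'.span_red, hru, span_range_sum_elim]
  have hV₂ : reduction p V₂ = Su ⊔ Sy := by
    rw [← hy'.span_red, hrv, span_range_sum_elim]
  have hWr : reduction p (V₁ ⊔ V₂) = Su ⊔ (Sx ⊔ Sy) := by
    rw [← hW.span_red, hrw, span_range_sum_elim, span_range_sum_elim]
  have hli := hW.linearIndependent_red
  rw [hrw] at hli
  obtain ⟨-, hli₂, hd₁⟩ := linearIndependent_sum.1 hli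
  simp only [Sum.elim_comp_inl, Sum.elim_comp_inr] at hli₂ hd₁
  obtain ⟨-, -, hd₂⟩ := linearIndependent_sum.1 hli₂
  simp only [Sum.elim_comp_inl, Sum.elim_comp_inr] at hd₂
  rw [span_range_sum_elim] at hd₁
  refine ⟨?_, ?_⟩
  · rw [hWr, hV₁, hV₂, sup_sup_sup_comm Su Sx Su Sy, sup_idem]
  · rw [hV₁, hV₂, hU]
    exact sup_inf_sup_eq_of_disjoint hd₁ hd₂

/-! ### Lemme 4.5 -/

/-- **Lemme 4.5 with its defect at a place.** For every place `𝔭` there is `t ≥ 0` with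
`h(U) + h(W) + t · deg 𝔭 ≤ h(V₁) + h(V₂)`, and `t = 0` forces `W̄ = V̄₁ + V̄₂`, `V̄₁ ∩ V̄₂ = Ū`
(summing (4.3) over all places: "en sommant les contributions de toutes les places `q` de `K` sur
`ℚ`, on en déduit `h(U) + h(W) + D ≤ h(V₁) + h(V₂)`" when the `𝔭`-adapted basis of `W` is not
regular). [cite: RoyWaldschmidt1997ENS, Lemme 4.5 (proof), p. 775] -/
theorem lemme_4_5_defect [IsAlgFunctionField k K] (V₁ V₂ : Submodule K (n → K)) (p : PlaceOver k K) :
    ∃ t : ℤ, 0 ≤ t ∧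
      subspaceHeight k (V₁ ⊓ V₂) + subspaceHeight k (V₁ ⊔ V₂) + t * p.degree ≤
        subspaceHeight k V₁ + subspaceHeight k V₂ ∧
      (t = 0 → reduction p (V₁ ⊔ V₂) = reduction p V₁ ⊔ reduction p V₂ ∧
        reduction p V₁ ⊓ reduction p V₂ = reduction p (V₁ ⊓ V₂)) := by
  obtain ⟨m₀, m₁, m₂, u, x, y, h⟩ := exists_adaptedBases V₁ V₂
  choose t ht0 hteq htzero using fun q : PlaceOver k K ↦ h.exists_defect q
  -- heights through the adapted bases
  have hU : subspaceHeight k (V₁ ⊓ V₂) = projHeight k (minors u) := subspaceHeight_eq h.li_u h.span_u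
  have hV₁ : subspaceHeight k V₁ = projHeight k (minors (Sum.elim u x)) :=
    subspaceHeight_eq h.li_ux h.span_ux
  have hV₂ : subspaceHeight k V₂ = projHeight k (minors (Sum.elim u y)) :=
    subspaceHeight_eq h.li_uy h.span_uy
  have hW : subspaceHeight k (V₁ ⊔ V₂) = projHeight k (minors (Sum.elim u (Sum.elim x y))) :=
    subspaceHeight_eq h.li_uxy h.span_uxy
  -- a common finite set of places
  obtain ⟨T₀, hT₀, -⟩ := exists_finset_places (k := k) {minors u} ∅
  obtain ⟨T₁, hT₁, -⟩ := exists_finset_places (k := k) {minors (Sum.elim u x)} ∅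
  obtain ⟨T₂, hT₂, -⟩ := exists_finset_places (k := k) {minors (Sum.elim u y)} ∅
  obtain ⟨T₃, hT₃, -⟩ := exists_finset_places (k := k) {minors (Sum.elim u (Sum.elim x y))} ∅
  set T := insert p (T₀ ∪ T₁ ∪ T₂ ∪ T₃) with hT
  have h0 : ∀ q, ordVec q (minors u) ≠ 0 → q ∈ T := fun q hq ↦ by
    simp [hT, hT₀ _ (by simp) q hq]
  have h1 : ∀ q, ordVec q (minors (Sum.elim u x)) ≠ 0 → q ∈ T := fun q hq ↦ by
    simp [hT, hT₁ _ (by simp) q hq]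
  have h2 : ∀ q, ordVec q (minors (Sum.elim u y)) ≠ 0 → q ∈ T := fun q hq ↦ by
    simp [hT, hT₂ _ (by simp) q hq]
  have h3 : ∀ q, ordVec q (minors (Sum.elim u (Sum.elim x y))) ≠ 0 → q ∈ T := fun q hq ↦ by
    simp [hT, hT₃ _ (by simp) q hq]
  rw [hU, hV₁, hV₂, hW, projHeight_eq_sum _ T h0, projHeight_eq_sum _ T h1,
    projHeight_eq_sum _ T h2, projHeight_eq_sum _ T h3]
  -- sum the identities `o₁ + o₂ + t = o₀ + o₃` weighted by the degrees
  have hsum : ∑ q ∈ T, -(ordVec q (minors (Sum.elim u x)) * (q.degree : ℤ)) +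
      ∑ q ∈ T, -(ordVec q (minors (Sum.elim u y)) * (q.degree : ℤ)) =
      ∑ q ∈ T, -(ordVec q (minors u) * (q.degree : ℤ)) +
      ∑ q ∈ T, -(ordVec q (minors (Sum.elim u (Sum.elim x y))) * (q.degree : ℤ)) +
      ∑ q ∈ T, t q * (q.degree : ℤ) := by
    rw [← Finset.sum_add_distrib, ← Finset.sum_add_distrib, ← Finset.sum_add_distrib]
    refine Finset.sum_congr rfl fun q _ ↦ ?_
    have := hteq q
    linear_combination (-(q.degree : ℤ)) * this
  have hS : t p * (p.degree : ℤ) ≤ ∑ q ∈ T, t q * (q.degree : ℤ) :=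
    Finset.single_le_sum (f := fun q ↦ t q * (q.degree : ℤ))
      (fun q _ ↦ mul_nonneg (ht0 q) (Nat.cast_nonneg _)) (Finset.mem_insert_self p _)
  refine ⟨t p, ht0 p, ?_, htzero p⟩
  linarith

/-- **Roy–Waldschmidt, Lemme 4.5 (4.1).** For subspaces `V₁, V₂ ⊆ Kⁿ`, `U = V₁ ∩ V₂`, `W = V₁ + V₂`:
`h(U) + h(W) ≤ h(V₁) + h(V₂)` (function-field analogue of Schmidt's Lemma 8A).
[cite: RoyWaldschmidt1997ENS, Lemme 4.5, p. 774] -/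
theorem lemme_4_5 [IsAlgFunctionField k K] (V₁ V₂ : Submodule K (n → K)) :
    subspaceHeight k (V₁ ⊓ V₂) + subspaceHeight k (V₁ ⊔ V₂) ≤
      subspaceHeight k V₁ + subspaceHeight k V₂ := by
  rcases isEmpty_or_nonempty (PlaceOver k K) with hE | ⟨⟨p⟩⟩
  · simp [subspaceHeight, projHeight, finsum_of_isEmpty]
  · obtain ⟨t, ht0, hle, -⟩ := lemme_4_5_defect (k := k) V₁ V₂ p
    nlinarith [Nat.cast_nonneg (α := ℤ) p.degree]

/-- **Roy–Waldschmidt, Lemme 4.5 (second part).** If moreover `h(V₁) + h(V₂) < D = deg 𝔭`, then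
reduction at `𝔭` commutes with sum and intersection: `W̄ = V̄₁ + V̄₂` and `Ū = V̄₁ ∩ V̄₂`.
[cite: RoyWaldschmidt1997ENS, Lemme 4.5, p. 774] -/
theorem lemme_4_5_reduction [IsAlgFunctionField k K] (p : PlaceOver k K) (V₁ V₂ : Submodule K (n → K))
    (hlt : subspaceHeight k V₁ + subspaceHeight k V₂ < p.degree) :
    reduction p (V₁ ⊔ V₂) = reduction p V₁ ⊔ reduction p V₂ ∧
      reduction p (V₁ ⊓ V₂) = reduction p V₁ ⊓ reduction p V₂ := by
  obtain ⟨t, ht0, hle, hzero⟩ := lemme_4_5_defect (k := k) V₁ V₂ p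
  have hU := subspaceHeight_nonneg (k := k) (V₁ ⊓ V₂)
  have hW := subspaceHeight_nonneg (k := k) (V₁ ⊔ V₂)
  have ht : t = 0 := by
    by_contra hne
    have h1 : (1 : ℤ) ≤ t := by omega
    nlinarith [Nat.cast_nonneg (α := ℤ) p.degree]
  obtain ⟨h1, h2⟩ := hzero ht
  exact ⟨h1, h2.symm⟩

end Adapted

end RoyWaldschmidt1997

end Literature.NumberTheory.Transcendental
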